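import Mathlib
import Summits.PneNP.PneNP.Theorems.SolvableImpliesStableSection.Negative.FalseWithoutSolvable

/-!
# Crux `SolvableImpliesStableSection` (stmt-PneNP-2463), line `Sketch` — target: `stub_transfer`
# is false without its solvability hypothesis (no typically-valid section in the unsatisfiable phase)

The lead's skeleton (`Cruxes/SolvableImpliesStableSection/Lines/Sketch.lean`) reduces the crux to
`stub_transfer`: poly-time solvability ⇒ for all `η, ν > 0` some constant `A` and, infinitely often,
a map `g` and a set `G` of instances with (i) `g` `ν`-valid on `G`, (ii) `(k m)·#Gᶜ ≤ A·#Inst`, and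
(iii) total `η n`-jump mass `≤ A·#Inst·2n` ("SmoothSection").  The engine proves SmoothSection ⇒ the
crux's conclusion.

**`stub_transfer_false_without_hsolv`.**  With the hypothesis `hsolv` deleted, `stub_transfer` is
FALSE: at `k = 3`, `α = 32`, `η = 1`, `ν = 1/128` conditions (i) ∧ (ii) alone are unsatisfiable for
large `n`, for EVERY `A`, `g`, `G` — by the instance-level first moment `card_instValid_le`
(`#{Φ : g Φ violates ≤ ν m clauses of Φ} ≤ 2^n (⌊ν m⌋₊+1) e^{m h₂(ν)} e^{-2^{-k}(1-ν) m} · #Inst`, read off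
the path-level count `card_originValid_le` through the product decomposition `card_filter_origin`),
(i) forces `#G < #Inst / 2` eventually, so (ii) forces `k m < 2A`, absurd as `m = ⌊α n⌋₊ → ∞`.
So SmoothSection is not a free-standing property of random 3-SAT at all densities: like the crux's own
conclusion (`solvableImpliesStableSection_false_without_solvable`), it can only be reached THROUGH the
solvability hypothesis — the density must enter any proof of stub 7 via `hsolv`.
(Standing disprover, cycle 1; the jump condition (iii) is not even used.)
-/

set_option linter.dupNamespace false

namespace Summit.PneNP.PneNP.Cruxes.SolvableImpliesStableSection.Negative

open Finset
open Summit.PneNP.PneNP.Cruxes.NoStableSection.DartGame (violCount)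

section InstLevel

variable {k m n : ℕ}

/-- **Instance-level first moment.** For any map `g` and `0 ≤ ν ≤ 1/2` (and `n ≥ 1`), the instances
`Φ` on which `g Φ` violates at most `ν m` clauses number at most
`2^n · (⌊ν m⌋₊ + 1) · e^{m h₂(ν)} · e^{-2^{-k}(1-ν) m} · #Inst` — the path-level count
`card_originValid_le` divided by `#Inst^k` via the product decomposition `card_filter_origin`. -/
theorem card_instValid_le (hn : 1 ≤ n) {ν : ℝ} (hν0 : 0 ≤ ν) (hν2 : ν ≤ 2⁻¹)
    (g : (Fin m → Fin k → Fin n × Bool) → (Fin n → Bool)) :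
    ((Finset.univ.filter fun Φ : Fin m → Fin k → Fin n × Bool =>
        (violCount (g Φ) Φ : ℝ) ≤ ν * m).card : ℝ) ≤
      (2 : ℝ) ^ n * ((⌊ν * m⌋₊ + 1) * Real.exp (m * Real.binEntropy ν)) *
        Real.exp (-((1 / 2 : ℝ) ^ k * ((1 - ν) * m))) *
        Fintype.card (Fin m → Fin k → Fin n × Bool) := by
  classical
  haveI : Nonempty (Fin n × Bool) := ⟨(⟨0, hn⟩, false)⟩
  have hI : (0 : ℝ) < Fintype.card (Fin m → Fin k → Fin n × Bool) := by
    exact_mod_cast Fintype.card_pos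
  have hIk : (0 : ℝ) < (Fintype.card (Fin m → Fin k → Fin n × Bool) : ℝ) ^ k := pow_pos hI k
  -- the path-level count for the predicate "valid at the origin", and its product decomposition
  have hpath := card_originValid_le (k := k) (m := m) (n := n) hν0 hν2 g
  have hdecomp := card_filter_origin (k := k) (m := m) (n := n)
    (fun Φ : Fin m → Fin k → Fin n × Bool => (violCount (g Φ) Φ : ℝ) ≤ ν * m)
  have hpaths : (Fintype.card (Fin (k + 1) → Fin m → Fin k → Fin n × Bool) : ℝ) =
      Fintype.card (Fin m → Fin k → Fin n × Bool) *
        (Fintype.card (Fin m → Fin k → Fin n × Bool) : ℝ) ^ k := by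
    rw [Fintype.card_fun (α := Fin (k + 1)), Fintype.card_fin, pow_succ']
    push_cast
    ring
  have hdecompR : ((Finset.univ.filter fun Ψ : Fin (k + 1) → Fin m → Fin k → Fin n × Bool =>
      (violCount (g (Ψ 0)) (Ψ 0) : ℝ) ≤ ν * m).card : ℝ) =
      ((Finset.univ.filter fun Φ : Fin m → Fin k → Fin n × Bool =>
        (violCount (g Φ) Φ : ℝ) ≤ ν * m).card : ℝ) *
        (Fintype.card (Fin m → Fin k → Fin n × Bool) : ℝ) ^ k := by
    exact_mod_cast hdecomp
  rw [hdecompR, hpaths] at hpath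
  -- cancel the positive factor `#Inst^k`
  refine le_of_mul_le_mul_right ?_ hIk
  calc ((Finset.univ.filter fun Φ : Fin m → Fin k → Fin n × Bool =>
        (violCount (g Φ) Φ : ℝ) ≤ ν * m).card : ℝ) *
        (Fintype.card (Fin m → Fin k → Fin n × Bool) : ℝ) ^ k
      ≤ (2 : ℝ) ^ n * ((⌊ν * m⌋₊ + 1) * Real.exp (m * Real.binEntropy ν)) *
          Real.exp (-((1 / 2 : ℝ) ^ k * ((1 - ν) * m))) *
          (Fintype.card (Fin m → Fin k → Fin n × Bool) *
            (Fintype.card (Fin m → Fin k → Fin n × Bool) : ℝ) ^ k) := hpath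
    _ = _ := by ring

end InstLevel

/-- For `α > 0`, eventually `⌊α n⌋₊ ≥ R`. -/
theorem eventually_floor_ge' {α : ℝ} (hα : 0 < α) (R : ℕ) :
    ∀ᶠ n : ℕ in Filter.atTop, R ≤ ⌊α * n⌋₊ :=
  (tendsto_nat_floor_atTop.comp (tendsto_natCast_atTop_atTop.const_mul_atTop hα)).eventually_ge_atTop R

/-- **`stub_transfer` of line `Sketch` is false without `hsolv`** (`stub_transfer_false_without_hsolv`):
the statement "for every `k ≥ 3` and all `α, η, ν > 0` there are `A > 0` and, infinitely often, a map
`g` and a set `G` of instances with `g` `ν`-valid on `G`, `(k m)·#Gᶜ ≤ A·#Inst`, and `η n`-jump mass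
`≤ A·#Inst·2n`" (verbatim the conclusion of `Sketch.stub_transfer`, universally closed over its
parameters) fails at `k = 3`, `α = 32`, `η = 1`, `ν = 1/128`: by `card_instValid_le` and the rate
computation of `eventually_firstMoment_lt` (`c = 1`), eventually fewer than half of the instances admit
that `g Φ` be `ν`-valid, so `#Gᶜ > #Inst/2` and the density condition forces `3 m < 2 A`,
impossible since `m = ⌊32 n⌋₊ → ∞`.  Hence `hsolv` is load-bearing in stub 7. -/
theorem stub_transfer_false_without_hsolv :
    ¬ (∀ k : ℕ, 3 ≤ k → ∀ α η ν : ℝ, 0 < α → 0 < η → 0 < ν →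
      ∃ A : ℝ, 0 < A ∧ ∃ᶠ n : ℕ in Filter.atTop, ∀ m : ℕ, m = ⌊α * n⌋₊ →
        ∃ g : (Fin m → Fin k → Fin n × Bool) → (Fin n → Bool),
        ∃ G : Finset (Fin m → Fin k → Fin n × Bool),
          (∀ Φ ∈ G, (((Finset.univ : Finset (Fin m)).filter fun i =>
              ∀ j, g Φ (Φ i j).1 ≠ (Φ i j).2).card : ℝ) ≤ ν * m) ∧
          ((k * m : ℕ) : ℝ) * (Gᶜ.card : ℝ) ≤ A * Fintype.card (Fin m → Fin k → Fin n × Bool) ∧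
          (∑ a : Fin m, ∑ b : Fin k,
              (((Finset.univ : Finset ((Fin m → Fin k → Fin n × Bool) × (Fin n × Bool))).filter
                fun p => η * n < hammingDist (g p.1)
                  (g (Function.update p.1 a (Function.update (p.1 a) b p.2)))).card : ℝ))
            ≤ A * (Fintype.card (Fin m → Fin k → Fin n × Bool) * (2 * n))) := by
  classical
  intro h
  obtain ⟨A, hA, hfreq⟩ := h 3 (by norm_num) 32 1 (1 / 128) (by norm_num) one_pos (by norm_num)
  -- the rate condition at the witness (as in `solvableImpliesStableSection_false_without_solvable`)
  have hrate : Real.log 2 + 1 < 32 * ((1 - 1 / 128) * (1 / 2) ^ 3 - Real.binEntropy (1 / 128)) := by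
    have h2 := Real.log_two_lt_d9
    have hH := binEntropy_inv128_le
    nlinarith
  have hfm := eventually_firstMoment_lt (k := 3) (show (0 : ℝ) < 32 by norm_num)
    (show (0 : ℝ) ≤ 1 / 128 by norm_num) (show (1 / 128 : ℝ) ≤ 2⁻¹ by norm_num) one_pos hrate
  obtain ⟨n, hn, hlt, hbig, hn1⟩ := (hfreq.and_eventually (hfm.and
    ((eventually_floor_ge' (show (0 : ℝ) < 32 by norm_num) (⌈A⌉₊ + 1)).and
      (Filter.eventually_ge_atTop 1)))).exists
  obtain ⟨g, G, hval, hdens, -⟩ := hn _ rfl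
  have hI : (0 : ℝ) < Fintype.card (Fin ⌊(32 : ℝ) * n⌋₊ → Fin 3 → Fin n × Bool) := by
    haveI : Nonempty (Fin n × Bool) := ⟨(⟨0, hn1⟩, false)⟩
    exact_mod_cast Fintype.card_pos
  -- (i) puts `G` inside the set of instances on which `g` is `ν`-valid
  have hGsub : G ⊆ Finset.univ.filter fun Φ : Fin ⌊(32 : ℝ) * n⌋₊ → Fin 3 → Fin n × Bool =>
      (violCount (g Φ) Φ : ℝ) ≤ 1 / 128 * ⌊(32 : ℝ) * n⌋₊ := by
    intro Φ hΦ
    simp only [Finset.mem_filter, Finset.mem_univ, true_and]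
    exact hval Φ hΦ
  -- the first moment: that set is smaller than `e^{-n} #Inst ≤ #Inst / 2`
  have hsmall := card_instValid_le (k := 3) (m := ⌊(32 : ℝ) * n⌋₊) hn1 (show (0 : ℝ) ≤ 1 / 128 by norm_num)
    (show (1 / 128 : ℝ) ≤ 2⁻¹ by norm_num) g
  have hexp : Real.exp (-(1 * (n : ℝ))) ≤ 1 / 2 := by
    have hn' : (1 : ℝ) ≤ n := by exact_mod_cast hn1
    have h1 : Real.exp (-(1 * (n : ℝ))) ≤ Real.exp (-1) := Real.exp_le_exp.2 (by linarith)
    have h2 : Real.exp (-1) ≤ 1 / 2 := by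
      have := Real.exp_one_gt_d9
      rw [Real.exp_neg]
      rw [inv_le_comm₀ (Real.exp_pos 1) (by norm_num)]
      linarith
    exact h1.trans h2
  have hGcard : (G.card : ℝ) ≤ 1 / 2 * Fintype.card (Fin ⌊(32 : ℝ) * n⌋₊ → Fin 3 → Fin n × Bool) := by
    calc (G.card : ℝ) ≤ ((Finset.univ.filter fun Φ : Fin ⌊(32 : ℝ) * n⌋₊ → Fin 3 → Fin n × Bool =>
          (violCount (g Φ) Φ : ℝ) ≤ 1 / 128 * ⌊(32 : ℝ) * n⌋₊).card : ℝ) := by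
          exact_mod_cast Finset.card_le_card hGsub
      _ ≤ (2 : ℝ) ^ n * ((⌊1 / 128 * (⌊(32 : ℝ) * n⌋₊ : ℝ)⌋₊ + 1) * Real.exp (⌊(32 : ℝ) * n⌋₊ * Real.binEntropy (1 / 128))) *
            Real.exp (-((1 / 2 : ℝ) ^ 3 * ((1 - 1 / 128) * ⌊(32 : ℝ) * n⌋₊))) *
            Fintype.card (Fin ⌊(32 : ℝ) * n⌋₊ → Fin 3 → Fin n × Bool) := hsmall
      _ ≤ Real.exp (-(1 * (n : ℝ))) * Fintype.card (Fin ⌊(32 : ℝ) * n⌋₊ → Fin 3 → Fin n × Bool) :=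
          mul_le_mul_of_nonneg_right hlt.le hI.le
      _ ≤ 1 / 2 * Fintype.card (Fin ⌊(32 : ℝ) * n⌋₊ → Fin 3 → Fin n × Bool) :=
          mul_le_mul_of_nonneg_right hexp hI.le
  -- hence `#Gᶜ ≥ #Inst / 2`
  have hGc : (1 / 2 : ℝ) * Fintype.card (Fin ⌊(32 : ℝ) * n⌋₊ → Fin 3 → Fin n × Bool) ≤ (Gᶜ.card : ℝ) := by
    have h1 : ((Gᶜ.card : ℕ) : ℝ) = Fintype.card (Fin ⌊(32 : ℝ) * n⌋₊ → Fin 3 → Fin n × Bool) - G.card := by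
      rw [Finset.card_compl, Nat.cast_sub (Finset.card_le_univ G)]
    rw [h1]
    linarith
  -- (ii) then forces `3 m ≤ 2 A`, contradicting `m ≥ ⌈A⌉₊ + 1`
  have hkm : ((3 * ⌊(32 : ℝ) * n⌋₊ : ℕ) : ℝ) * (1 / 2 * Fintype.card (Fin ⌊(32 : ℝ) * n⌋₊ → Fin 3 → Fin n × Bool)) ≤
      A * Fintype.card (Fin ⌊(32 : ℝ) * n⌋₊ → Fin 3 → Fin n × Bool) :=
    le_trans (mul_le_mul_of_nonneg_left hGc (Nat.cast_nonneg _)) hdens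
  have hkm' : ((3 * ⌊(32 : ℝ) * n⌋₊ : ℕ) : ℝ) * (1 / 2) ≤ A := by
    have := hkm
    rw [← mul_assoc] at this
    exact le_of_mul_le_mul_right this hI
  have hmbig : (⌈A⌉₊ : ℝ) + 1 ≤ (⌊(32 : ℝ) * n⌋₊ : ℝ) := by exact_mod_cast hbig
  have hAceil : A ≤ ⌈A⌉₊ := Nat.le_ceil A
  push_cast at hkm'
  nlinarith

end Summit.PneNP.PneNP.Cruxes.SolvableImpliesStableSection.Negative
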